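import Summits.QuantumFields.YangMills.Theorems.PoincareLipschitzMonotonicityEqualityLetters
import Summits.QuantumFields.YangMills.Theorems.PoincareLipschitzRadialVariation
import Mathlib.MeasureTheory.Measure.Lebesgue.VolumeOfBalls
import Mathlib.Analysis.InnerProductSpace.Calculus
import Mathlib.Analysis.SpecialFunctions.Sqrt
import HarnessLib

/-!
# Crux `BlockLipschitzL` (stmt-QuantumFields-23533) ∕ `HistoryTailL` (stmt-QuantumFields-19936), LINE 25 «CompactnessTransfer»,
# stub S1″ — the (TM) road, file TM-F1 «RADIAL PUSH-FORWARDS AND RADIAL TEST FUNCTIONS ON `ℝ³`»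

Cell `ym3-torus` (YM ladder rung R3 = continuum SU(2) Yang–Mills on T³ — a RUNG, NOT Clay: not d = 4, not infinite volume,
not a mass gap); WIDTH helper seat `ym3-torus-px3` g9 (LEAD ★w1-19936 g10 «GO (i)» 15:27:31Z); `--supports
stmt-QuantumFields-23533`; THEOREMS ONLY (0 `def`, 0 `sorry`, default heartbeats); imports TM-C1 ✓`…MonotonicityEqualityLetters`,
w2's ✓`…RadialVariation` (`sum_coord_sub_sq`), Mathlib (`volume_ball_fin_three`, `HasFDerivAt.norm_sq`, `HasFDerivAt.sqrt`).

WHAT THIS FILE DOES (letters for TM-F2 «the density cap `Θ ≤ 3π`»; `E³ = EuclideanSpace ℝ (Fin 3)`):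
* §1 ★★ `setIntegral_radial_mul_eq_of_ball_linear'` — TM-C1's radial push-forward for a merely MEASURABLE profile `k`:
  `∫_{B_R(y)} k(dist(x,y))·f(x) dx = Θ·∫₀^R k` when `∫_{B_r(y)} f = Θ·r` (`0 < r ≤ R`), `f ≥ 0` integrable.
* §2 ★★ `setIntegral_radial_eq_volume` — THE LEBESGUE TWIN: `∫_{B_R(y)} k(dist(x,y)) dx = ∫₀^R 4πr²·k(r) dr` for measurable `k`
  (the push-forward of `dx⌊B_R(y)` under `dist(·,y)` is `4πr²dr⌊(0,R]`: π-system uniqueness on rays, `volume_ball_fin_three`).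
* §3 RADIAL TEST FUNCTIONS `ζ(x) = F(‖x − y‖)` for a profile `F` vanishing on `(−∞, δ)` (`δ > 0`) and `C^∞` at every `r > 0`:
  ★ `contDiff_radial`, ★ `hasFDerivAt_radial` (`Dζ(x)v = F′(‖x−y‖)·⟪x−y, v⟫∕‖x−y‖`, `x ≠ y`), ★★ `sum_fderiv_radial_sq`
  (`Σᵢ (∂ᵢζ)² = F′(‖x−y‖)²` at EVERY `x`), ★ `tsupport_radial_subset`.
HONEST SCOPE.  Letters only; nothing of (TM), (ZD), (C), S1″, K1, `MeanDeviationL`, `BlockLipschitzL`, `HistoryTailL` is proved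
here.  YM₃ on T³ is rung R3, not Clay; YM gap NOT proved; no summit statement is proved here.

References: R. Schoen, K. Uhlenbeck, Invent. Math. 78 (1984) [SchoenUhlenbeck1984] (§1: radial test functions in the
stability inequality, Lemma 1.3); L. Simon (1996) [Simon1996] (§2.4, §3.1); L. C. Evans, R. F. Gariepy (1992) [EvansGariepy1992] (§1.1).
-/

set_option autoImplicit false

noncomputable section

open scoped BigOperators Topology ENNReal NNReal RealInnerProductSpace ContDiff
open MeasureTheory Set Filter Metric Function TopologicalSpace

namespace Summit.QuantumFields.YangMills.Theorems.PoincareLipschitzRadialPushforward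

open Summit.QuantumFields.YangMills.Theorems.PoincareLipschitzMonotonicityEqualityLetters (ball_inter_ball_eq_min preimage_dist_Iio)
open Summit.QuantumFields.YangMills.Theorems.PoincareLipschitzRadialVariation (sum_coord_sub_sq)

/-! ## §1 The radial push-forward of a density with linear ball integrals, measurable profile -/

/-- ★★ **THE RADIAL PUSH-FORWARD, MEASURABLE PROFILE.**  TM-C1's ✓`setIntegral_radial_mul_eq_of_ball_linear` with `k` merely
measurable: `∫_{B_R(y)} k(dist(x, y))·f(x) dx = Θ·∫₀^R k` when `f ≥ 0` is integrable on `B_R(y)` with `∫_{B_r(y)} f = Θ·r` for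
`0 < r ≤ R`. [cite: Simon1996, §2.4 and §3.1; EvansGariepy1992, §1.1] -/
theorem setIntegral_radial_mul_eq_of_ball_linear' {y : EuclideanSpace ℝ (Fin 3)} {R Θ : ℝ} (hR : 0 < R)
    {f : EuclideanSpace ℝ (Fin 3) → ℝ} (hf0 : ∀ x, 0 ≤ f x) (hfi : IntegrableOn f (ball y R) volume)
    (hE : ∀ r : ℝ, 0 < r → r ≤ R → ∫ x in ball y r, f x = Θ * r) {k : ℝ → ℝ} (hk : Measurable k) :
    ∫ x in ball y R, k (dist x y) * f x = Θ * ∫ r in (0:ℝ)..R, k r := by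
  have hΘ : 0 ≤ Θ := by
    have h := hE R hR le_rfl
    have h0 : 0 ≤ ∫ x in ball y R, f x := setIntegral_nonneg measurableSet_ball fun x _ => hf0 x
    nlinarith
  set μ : Measure (EuclideanSpace ℝ (Fin 3)) :=
    (volume.restrict (ball y R)).withDensity (fun x => ((f x).toNNReal : ℝ≥0∞)) with hμ_def
  have hfm : AEMeasurable (fun x => (f x).toNNReal) (volume.restrict (ball y R)) :=
    hfi.aestronglyMeasurable.aemeasurable.real_toNNReal
  have hμball : ∀ a : ℝ, μ (ball y a) = ENNReal.ofReal (∫ x in ball y (min a R), f x) := by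
    intro a
    rw [hμ_def, withDensity_apply _ measurableSet_ball, Measure.restrict_restrict measurableSet_ball,
      ball_inter_ball_eq_min]
    have hfi' : IntegrableOn f (ball y (min a R)) volume := hfi.mono_set (ball_subset_ball (min_le_right _ _))
    rw [ofReal_integral_eq_lintegral_ofReal hfi' (ae_of_all _ fun x => hf0 x)]
    rfl
  have hμuniv : μ univ = ENNReal.ofReal (Θ * R) := by
    rw [hμ_def, withDensity_apply _ MeasurableSet.univ, Measure.restrict_univ, ← hE R hR le_rfl,
      ofReal_integral_eq_lintegral_ofReal hfi (ae_of_all _ fun x => hf0 x)]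
    rfl
  haveI hμfin : IsFiniteMeasure μ := ⟨by rw [hμuniv]; exact ENNReal.ofReal_lt_top⟩
  have hdm : Measurable (fun x : EuclideanSpace ℝ (Fin 3) => dist x y) := (continuous_id.dist continuous_const).measurable
  set ν : Measure ℝ := μ.map (fun x => dist x y) with hν_def
  haveI hνfin : IsFiniteMeasure ν := Measure.isFiniteMeasure_map _ _
  set ν' : Measure ℝ := ENNReal.ofReal Θ • volume.restrict (Ioc (0:ℝ) R) with hν'_def
  have hray : ∀ a : ℝ, ν (Iio a) = ν' (Iio a) := by
    intro a
    rw [hν_def, Measure.map_apply hdm measurableSet_Iio, preimage_dist_Iio, hμball, hν'_def, Measure.smul_apply,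
      Measure.restrict_apply measurableSet_Iio, smul_eq_mul]
    by_cases ha : a ≤ 0
    · have h1 : ball y (min a R) = ∅ := ball_eq_empty.2 ((min_le_left _ _).trans ha)
      have h2 : Iio a ∩ Ioc (0:ℝ) R = ∅ := by
        ext r; simp only [mem_inter_iff, mem_Iio, mem_Ioc, mem_empty_iff_false, iff_false]; intro h; linarith [h.1, h.2.1]
      rw [h1, h2, Measure.restrict_empty, integral_zero_measure, measure_empty, ENNReal.ofReal_zero, mul_zero]
    · push Not at ha
      have hm : 0 < min a R := lt_min ha hR
      rw [hE (min a R) hm (min_le_right _ _), ENNReal.ofReal_mul hΘ]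
      congr 1
      by_cases haR : a ≤ R
      · have h2 : Iio a ∩ Ioc (0:ℝ) R = Ioo 0 a := by
          ext r; simp only [mem_inter_iff, mem_Iio, mem_Ioc, mem_Ioo]
          constructor
          · rintro ⟨h1, h2, _⟩; exact ⟨h2, h1⟩
          · rintro ⟨h1, h2⟩; exact ⟨h2, h1, h2.le.trans haR⟩
        rw [h2, Real.volume_Ioo, min_eq_left haR, sub_zero]
      · push Not at haR
        have h2 : Iio a ∩ Ioc (0:ℝ) R = Ioc 0 R := by
          ext r; simp only [mem_inter_iff, mem_Iio, mem_Ioc]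
          constructor
          · rintro ⟨_, h2, h3⟩; exact ⟨h2, h3⟩
          · rintro ⟨h2, h3⟩; exact ⟨lt_of_le_of_lt h3 haR, h2, h3⟩
        rw [h2, Real.volume_Ioc, min_eq_right haR.le, sub_zero]
  have hνeq : ν = ν' := by
    refine ext_of_generate_finite (range (Iio : ℝ → Set ℝ)) ?_ isPiSystem_Iio ?_ ?_
    · rw [← borel_eq_generateFrom_Iio]; exact BorelSpace.measurable_eq
    · rintro s ⟨a, rfl⟩; exact hray a
    · rw [hν_def, Measure.map_apply hdm MeasurableSet.univ, preimage_univ, hμuniv, hν'_def, Measure.smul_apply,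
        Measure.restrict_apply MeasurableSet.univ, univ_inter, Real.volume_Ioc, smul_eq_mul, ← ENNReal.ofReal_mul hΘ, sub_zero]
  have hkm : AEStronglyMeasurable k ν := hk.aestronglyMeasurable
  have h1 : ∫ r, k r ∂ν = ∫ x, k (dist x y) ∂μ := integral_map hdm.aemeasurable hkm
  have h2 : ∫ x, k (dist x y) ∂μ = ∫ x in ball y R, k (dist x y) * f x := by
    rw [hμ_def, integral_withDensity_eq_integral_smul₀ hfm]
    refine integral_congr_ae (ae_of_all _ fun x => ?_)
    show (f x).toNNReal • k (dist x y) = k (dist x y) * f x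
    rw [NNReal.smul_def, Real.coe_toNNReal _ (hf0 x), smul_eq_mul, mul_comm]
  have h3 : ∫ r, k r ∂ν' = Θ * ∫ r in (0:ℝ)..R, k r := by
    rw [hν'_def, integral_smul_measure, ENNReal.toReal_ofReal hΘ, intervalIntegral.integral_of_le hR.le, smul_eq_mul]
  rw [← h2, ← h1, hνeq, h3]

/-! ## §2 The Lebesgue twin: `dx⌊B_R(y)` pushes forward to `4πr² dr` -/

/-- ★★ **THE LEBESGUE RADIAL PUSH-FORWARD ON `ℝ³`.**  For measurable `k : ℝ → ℝ` and `R > 0`: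
`∫_{B_R(y)} k(dist(x, y)) dx = ∫₀^R (4π r²)·k(r) dr`.  Proof: the finite measures `map (dist(·,y)) (dx⌊B_R(y))` and
`(4πr²)·dr⌊(0,R]` agree on every ray `Iio a` (`volume_ball_fin_three`: both give `(4π∕3)·min(a,R)₊³`), hence everywhere; integrate `k`.
[cite: EvansGariepy1992, §1.1; Simon1996, §2.4] -/
theorem setIntegral_radial_eq_volume (y : EuclideanSpace ℝ (Fin 3)) {R : ℝ} (hR : 0 < R) {k : ℝ → ℝ} (hk : Measurable k) :
    ∫ x in ball y R, k (dist x y) = ∫ r in (0:ℝ)..R, (4 * Real.pi * r ^ 2) * k r := by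
  set μ : Measure (EuclideanSpace ℝ (Fin 3)) := volume.restrict (ball y R) with hμ_def
  haveI hμfin : IsFiniteMeasure μ := by
    rw [hμ_def]; exact isFiniteMeasure_restrict.2 (measure_ball_lt_top.ne)
  have hdm : Measurable (fun x : EuclideanSpace ℝ (Fin 3) => dist x y) := (continuous_id.dist continuous_const).measurable
  set ν : Measure ℝ := μ.map (fun x => dist x y) with hν_def
  haveI hνfin : IsFiniteMeasure ν := Measure.isFiniteMeasure_map _ _
  -- the density `4πr²` on `(0, R]`
  set w : ℝ → ℝ := fun r => 4 * Real.pi * r ^ 2 with hw_def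
  have hwc : Continuous w := by rw [hw_def]; fun_prop
  have hw0 : ∀ r, 0 ≤ w r := fun r => by rw [hw_def]; positivity
  set ν' : Measure ℝ := (volume.restrict (Ioc (0:ℝ) R)).withDensity (fun r => ((w r).toNNReal : ℝ≥0∞)) with hν'_def
  have hwm : AEMeasurable (fun r => (w r).toNNReal) (volume.restrict (Ioc (0:ℝ) R)) :=
    hwc.measurable.real_toNNReal.aemeasurable
  -- the primitive of `4πr²`
  have hprim : ∀ a b : ℝ, ∫ r in a..b, w r = 4 * Real.pi / 3 * (b ^ 3 - a ^ 3) := by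
    intro a b
    rw [hw_def, intervalIntegral.integral_const_mul, integral_pow]
    ring
  -- the measure `ν'` of a ray `Iio m`, `0 ≤ m ≤ R`
  have hν'Iio : ∀ m : ℝ, 0 ≤ m → m ≤ R → ν' (Iio m) = ENNReal.ofReal (4 * Real.pi / 3 * m ^ 3) := by
    intro m hm0 hmR
    rw [hν'_def, withDensity_apply _ measurableSet_Iio, Measure.restrict_restrict measurableSet_Iio]
    have hset : Iio m ∩ Ioc (0:ℝ) R = Ioo 0 m := by
      ext r; simp only [mem_inter_iff, mem_Iio, mem_Ioc, mem_Ioo]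
      constructor
      · rintro ⟨h1, h2, _⟩; exact ⟨h2, h1⟩
      · rintro ⟨h1, h2⟩; exact ⟨h2, h1, h2.le.trans hmR⟩
    rw [hset, Measure.restrict_congr_set Ioo_ae_eq_Ioc]
    have hwi : IntegrableOn w (Ioc 0 m) volume := (hwc.integrableOn_Icc).mono_set Ioc_subset_Icc_self
    have h1 : ∫⁻ r in Ioc 0 m, ((w r).toNNReal : ℝ≥0∞) = ENNReal.ofReal (∫ r in Ioc 0 m, w r) := by
      rw [ofReal_integral_eq_lintegral_ofReal hwi (ae_of_all _ fun r => hw0 r)]; rfl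
    rw [h1, ← intervalIntegral.integral_of_le hm0, hprim]
    simp
  -- `ν'` does not charge `[R, ∞)`
  have hzR : ν' (Ici R) = 0 := by
    rw [hν'_def, withDensity_apply _ measurableSet_Ici, Measure.restrict_restrict measurableSet_Ici]
    have : Ici R ∩ Ioc (0:ℝ) R ⊆ {R} := by
      rintro r ⟨h1, _, h3⟩; exact le_antisymm h3 h1
    exact setLIntegral_measure_zero _ _ (measure_mono_null this (by simp))
  have hν'split : ∀ a : ℝ, R ≤ a → ν' (Iio a) = ν' (Iio R) := by
    intro a ha
    apply le_antisymm _ (measure_mono (Iio_subset_Iio ha))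
    have : Iio a ⊆ Iio R ∪ Ici R := fun r _ => (lt_or_ge r R).elim (fun h => Or.inl h) (fun h => Or.inr h)
    refine (measure_mono this).trans ((measure_union_le _ _).trans ?_)
    rw [hzR, add_zero]
  have hray : ∀ a : ℝ, ν (Iio a) = ν' (Iio a) := by
    intro a
    rw [hν_def, Measure.map_apply hdm measurableSet_Iio, preimage_dist_Iio, hμ_def, Measure.restrict_apply measurableSet_ball,
      ball_inter_ball_eq_min]
    by_cases ha : a ≤ 0
    · have h1 : ball y (min a R) = ∅ := ball_eq_empty.2 ((min_le_left _ _).trans ha)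
      have h2 : ν' (Iio a) = 0 := by
        refine measure_mono_null (fun r hr => ?_) (show ν' (Iio 0) = 0 from ?_)
        · exact lt_of_lt_of_le hr ha
        · rw [hν'Iio 0 le_rfl hR.le]; simp
      rw [h1, h2, measure_empty]
    · push Not at ha
      have hm : 0 < min a R := lt_min ha hR
      have hνa : ν' (Iio a) = ν' (Iio (min a R)) := by
        by_cases haR : a ≤ R
        · rw [min_eq_left haR]
        · push Not at haR
          rw [min_eq_right haR.le, hν'split a haR.le]
      rw [hνa, hν'Iio (min a R) hm.le (min_le_right _ _), EuclideanSpace.volume_ball_fin_three]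
      rw [← ENNReal.ofReal_pow hm.le, ← ENNReal.ofReal_mul (by positivity)]
      congr 1; ring
  have hνeq : ν = ν' := by
    haveI : IsFiniteMeasure ν' := ⟨by
      have huniv : ν' univ ≤ ν' (Iio R) + ν' (Ici R) := by
        rw [← Iio_union_Ici (a := R)]; exact measure_union_le _ _
      rw [hzR, add_zero, hν'Iio R hR.le le_rfl] at huniv
      exact lt_of_le_of_lt huniv ENNReal.ofReal_lt_top⟩
    refine ext_of_generate_finite (range (Iio : ℝ → Set ℝ)) ?_ isPiSystem_Iio ?_ ?_
    · rw [← borel_eq_generateFrom_Iio]; exact BorelSpace.measurable_eq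
    · rintro s ⟨a, rfl⟩; exact hray a
    · -- total masses: both measures are carried by the ray `Iio (R + 1)`
      have h1 : ν univ = ν (Iio (R + 1)) := by
        rw [hν_def, Measure.map_apply hdm MeasurableSet.univ, Measure.map_apply hdm measurableSet_Iio, preimage_univ,
          preimage_dist_Iio, hμ_def, Measure.restrict_apply MeasurableSet.univ, Measure.restrict_apply measurableSet_ball,
          univ_inter, ball_inter_ball_eq_min, min_eq_right (by linarith : R ≤ R + 1)]
      have h2 : ν' univ = ν' (Iio (R + 1)) := by
        apply le_antisymm _ (measure_mono (subset_univ _))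
        have : (univ : Set ℝ) ⊆ Iio (R + 1) ∪ Ici R :=
          fun r _ => (lt_or_ge r R).elim (fun h => Or.inl (lt_trans h (by linarith))) (fun h => Or.inr h)
        refine (measure_mono this).trans ((measure_union_le _ _).trans ?_)
        rw [hzR, add_zero]
      rw [h1, h2, hray]
  have hkm : AEStronglyMeasurable k ν := hk.aestronglyMeasurable
  have h1 : ∫ r, k r ∂ν = ∫ x, k (dist x y) ∂μ := integral_map hdm.aemeasurable hkm
  have h3 : ∫ r, k r ∂ν' = ∫ r in (0:ℝ)..R, (4 * Real.pi * r ^ 2) * k r := by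
    rw [hν'_def, integral_withDensity_eq_integral_smul₀ hwm, intervalIntegral.integral_of_le hR.le]
    refine integral_congr_ae (ae_of_all _ fun r => ?_)
    show (w r).toNNReal • k r = (4 * Real.pi * r ^ 2) * k r
    rw [NNReal.smul_def, Real.coe_toNNReal _ (hw0 r), smul_eq_mul]
  rw [hμ_def] at h1
  rw [← h1, hνeq, h3]

/-! ## §3 Radial test functions -/

section Radial

variable {F : ℝ → ℝ} {δ : ℝ}

/-- A profile vanishing on `(−∞, δ)`, `δ > 0`, and `C^∞` at every `r > 0`, is `C^∞` on `ℝ`. [folklore] -/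
theorem contDiff_profile (hδ : 0 < δ) (hF0 : ∀ r : ℝ, r < δ → F r = 0) (hF : ∀ r : ℝ, 0 < r → ContDiffAt ℝ ∞ F r) :
    ContDiff ℝ ∞ F := by
  refine contDiff_iff_contDiffAt.2 fun r => ?_
  by_cases hr : 0 < r
  · exact hF r hr
  · have hev : F =ᶠ[𝓝 r] fun _ => 0 := by
      filter_upwards [Iio_mem_nhds (show r < δ by linarith)] with s hs using hF0 s hs
    exact (contDiffAt_const (c := (0:ℝ))).congr_of_eventuallyEq hev

/-- ★ **RADIAL TEST FUNCTIONS ARE SMOOTH**: `x ↦ F(‖x − y‖)` is `C^∞` for such a profile. [cite: SchoenUhlenbeck1984, §1 (radial test functions)] -/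
theorem contDiff_radial (y : EuclideanSpace ℝ (Fin 3)) (hδ : 0 < δ) (hF0 : ∀ r : ℝ, r < δ → F r = 0)
    (hF : ∀ r : ℝ, 0 < r → ContDiffAt ℝ ∞ F r) :
    ContDiff ℝ ∞ (fun x : EuclideanSpace ℝ (Fin 3) => F ‖x - y‖) := by
  refine contDiff_iff_contDiffAt.2 fun x => ?_
  by_cases hx : x - y = 0
  · -- near `y` the function vanishes identically
    have hev : (fun x : EuclideanSpace ℝ (Fin 3) => F ‖x - y‖) =ᶠ[𝓝 x] fun _ => 0 := by
      have hxy : x = y := sub_eq_zero.1 hx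
      subst hxy
      filter_upwards [Metric.ball_mem_nhds x hδ] with z hz
      exact hF0 _ (by rwa [mem_ball, dist_eq_norm] at hz)
    exact (contDiffAt_const (c := (0:ℝ))).congr_of_eventuallyEq hev
  · have h1 : ContDiffAt ℝ ∞ (fun x : EuclideanSpace ℝ (Fin 3) => ‖x - y‖) x :=
      (contDiffAt_id.sub contDiffAt_const).norm ℝ hx
    exact (hF ‖x - y‖ (norm_pos_iff.2 hx)).comp x h1

/-- ★★ **THE DIRICHLET DENSITY OF A RADIAL FUNCTION**: `Σᵢ (∂ᵢ F(‖·−y‖))(x)² = F′(‖x − y‖)²` at EVERY `x` (at `x = y` both sides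
vanish since `F = 0` near `0`); off the centre the chain rule through `‖x − y‖ = √(‖x − y‖²)` gives
`∂ᵢ F(‖·−y‖)(x) = F′(‖x−y‖)·(xᵢ − yᵢ)∕‖x−y‖`. [cite: SchoenUhlenbeck1984, §1] -/
theorem sum_fderiv_radial_sq (y : EuclideanSpace ℝ (Fin 3)) (hδ : 0 < δ) (hF0 : ∀ r : ℝ, r < δ → F r = 0)
    (hF : ∀ r : ℝ, 0 < r → ContDiffAt ℝ ∞ F r) (x : EuclideanSpace ℝ (Fin 3)) :
    ∑ i : Fin 3, (fderiv ℝ (fun x : EuclideanSpace ℝ (Fin 3) => F ‖x - y‖) x (EuclideanSpace.single i (1:ℝ))) ^ 2 =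
      (deriv F ‖x - y‖) ^ 2 := by
  by_cases hx : x - y = 0
  · -- at the centre: the function vanishes near `x = y`, and `F′(0) = 0`
    have hxy : x = y := sub_eq_zero.1 hx
    subst hxy
    have hev : (fun z : EuclideanSpace ℝ (Fin 3) => F ‖z - x‖) =ᶠ[𝓝 x] fun _ => 0 := by
      filter_upwards [Metric.ball_mem_nhds x hδ] with z hz
      exact hF0 _ (by rwa [mem_ball, dist_eq_norm] at hz)
    have hfd : fderiv ℝ (fun z : EuclideanSpace ℝ (Fin 3) => F ‖z - x‖) x = 0 := by
      rw [hev.fderiv_eq]; exact fderiv_const_apply 0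
    have hF'0 : deriv F 0 = 0 := by
      have hev' : F =ᶠ[𝓝 (0:ℝ)] fun _ => 0 := by
        filter_upwards [Iio_mem_nhds hδ] with s hs using hF0 s hs
      rw [hev'.deriv_eq]; exact deriv_const 0 0
    simp [hfd, hF'0]
  · have hn0 : ‖x - y‖ ≠ 0 := norm_ne_zero_iff.2 hx
    have hs0 : ‖x - y‖ ^ 2 ≠ 0 := pow_ne_zero 2 hn0
    have hsqrt : Real.sqrt (‖x - y‖ ^ 2) = ‖x - y‖ := Real.sqrt_sq (norm_nonneg _)
    -- the chain `F ∘ √ ∘ ‖· − y‖²`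
    have hg : HasFDerivAt (fun z : EuclideanSpace ℝ (Fin 3) => ‖z - y‖ ^ 2)
        ((2:ℕ) • (innerSL ℝ (x - y)).comp (ContinuousLinearMap.id ℝ (EuclideanSpace ℝ (Fin 3)))) x := by
      have := ((hasFDerivAt_id x).sub_const y).norm_sq
      simpa only [id] using this
    have hFd : HasDerivAt F (deriv F ‖x - y‖) (Real.sqrt (‖x - y‖ ^ 2)) := by
      rw [hsqrt]; exact ((hF _ (norm_pos_iff.2 hx)).differentiableAt (by simp)).hasDerivAt
    have hq : HasDerivAt (fun s : ℝ => F (Real.sqrt s)) (deriv F ‖x - y‖ * (1 / (2 * Real.sqrt (‖x - y‖ ^ 2)))) (‖x - y‖ ^ 2) :=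
      hFd.comp _ (Real.hasDerivAt_sqrt hs0)
    have hζ' := hq.comp_hasFDerivAt x hg
    have heq : ((fun s : ℝ => F (Real.sqrt s)) ∘ fun z : EuclideanSpace ℝ (Fin 3) => ‖z - y‖ ^ 2) = fun z => F ‖z - y‖ := by
      funext z; simp only [Function.comp_apply, Real.sqrt_sq (norm_nonneg _)]
    have hζ : HasFDerivAt (fun z : EuclideanSpace ℝ (Fin 3) => F ‖z - y‖)
        ((deriv F ‖x - y‖ * (1 / (2 * Real.sqrt (‖x - y‖ ^ 2)))) •
          ((2:ℕ) • (innerSL ℝ (x - y)).comp (ContinuousLinearMap.id ℝ (EuclideanSpace ℝ (Fin 3))))) x := heq ▸ hζ'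
    have hinner : ∀ i : Fin 3, ⟪x - y, EuclideanSpace.single i (1:ℝ)⟫ = (x - y) i := fun i => by
      rw [EuclideanSpace.inner_single_right]; simp
    have hfi : ∀ i : Fin 3, fderiv ℝ (fun z : EuclideanSpace ℝ (Fin 3) => F ‖z - y‖) x (EuclideanSpace.single i (1:ℝ)) =
        deriv F ‖x - y‖ * ‖x - y‖⁻¹ * (x - y) i := by
      intro i
      rw [hζ.fderiv]
      have h2 : (((2:ℕ) • (innerSL ℝ (x - y)).comp (ContinuousLinearMap.id ℝ (EuclideanSpace ℝ (Fin 3))))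
          (EuclideanSpace.single i (1:ℝ)) : ℝ) = 2 * ⟪x - y, EuclideanSpace.single i (1:ℝ)⟫ := by
        simp [two_mul, inner_sub_left]
      show (deriv F ‖x - y‖ * (1 / (2 * Real.sqrt (‖x - y‖ ^ 2)))) •
          ((((2:ℕ) • (innerSL ℝ (x - y)).comp (ContinuousLinearMap.id ℝ (EuclideanSpace ℝ (Fin 3))))
            (EuclideanSpace.single i (1:ℝ)) : ℝ)) = _
      rw [h2, hinner i, hsqrt, smul_eq_mul]
      field_simp
    simp_rw [hfi, mul_pow]
    rw [← Finset.mul_sum]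
    have hsum : ∑ i : Fin 3, ((x - y) i) ^ 2 = ‖x - y‖ ^ 2 := by
      rw [← sum_coord_sub_sq x y]; exact Finset.sum_congr rfl fun i _ => by rw [PiLp.sub_apply]
    rw [hsum]
    field_simp

/-- ★ **SUPPORT OF A RADIAL TEST FUNCTION**: if `F = 0` on `[R, ∞)` then `tsupport (F(‖·−y‖)) ⊆ B̄_R(y)`. [folklore] -/
theorem tsupport_radial_subset (y : EuclideanSpace ℝ (Fin 3)) {R : ℝ} (hFR : ∀ r : ℝ, R ≤ r → F r = 0) :
    tsupport (fun x : EuclideanSpace ℝ (Fin 3) => F ‖x - y‖) ⊆ closedBall y R := by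
  refine closure_minimal (fun x hx => ?_) isClosed_closedBall
  rw [mem_closedBall, dist_eq_norm]
  by_contra h
  exact hx (hFR _ (not_le.1 h).le)

end Radial

end Summit.QuantumFields.YangMills.Theorems.PoincareLipschitzRadialPushforward

end
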